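import Summits.FinalStateConjecture.FinalStateConjecture.Theorems.BartnikGapSettlingSettledCaptureCrushDefs
import Summits.FinalStateConjecture.FinalStateConjecture.Theorems.BartnikGapSettlingGapExhaustionMetricInCoordsCompAffine
import Literature.Geometry.Lorentzian.BackgroundChartCalculus
import Literature.Geometry.Lorentzian.KerrSchildCoord
import HarnessLib

/-!
# Crux `SettledCapture` (stmt-FinalStateConjecture-17328), line `null-concave-crush`, stub
# `stub_crushTransport` — part 4/5: the `η`-good interior chart in rest-frame Kerr–Schild coordinates

Route `BartnikGapSettling`; helper module (`--supports stmt-FinalStateConjecture-17328`) of the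
registered stub `stub_crushTransport`, vocabulary of `Theorems/BartnikGapSettlingSettledCaptureCrushDefs.lean`.
For an interior chart `Φ` on the domain of the boosted ingoing-Kerr background `interiorBackground mo M a r₋`
(motion `mo = (Λ, c)`), the parametrisation `ψ' = Φ ∘ (chartAt E4 x₀).symm ∘ (y ↦ c + Λ y)` by the
rest-frame coordinates `y = Λ⁻¹(x − c)` (`poincareInv`) satisfies `ψ'(Λ⁻¹(x − c)) = Φ x`, and the late
shell `lateShell … T r₁ r₂` corresponds to the coordinate shell `{T < y⁰, r₁ < r(a, y) < r₂}`
(`crushTransport_chart_image`). If `Φ` is `η`-good on that shell (`IsGoodInteriorChart`, `η = ofReal η₀`)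
then on the coordinate shell `ψ'` is `C^∞`, injective, its components `ψ'^* g` are `C¹`-within
`‖Λ‖² η₀` / `‖Λ‖³ η₀` of the Kerr–Schild components `g_{M,a}` (transformation law of the components under
the affine change of chart, `stub_metricInCoords_comp_affine`, O'Neill 1983, Ch. 3, p. 58, and the
dictionary `metricInCoords − g₀ = deviation` of `BackgroundChartCalculus.lean`), and it pushes the Kerr
field `V_{M,a}` forward to a future-directed vector (`crushTransport_chart_package`).

## References
* B. O'Neill, *Semi-Riemannian geometry with applications to relativity*, Academic Press 1983, Ch. 3,
  Cor. 21, Lemma 22, Lemma 3.49, Prop. 3.59 and pp. 90–91; Ch. 5, Lemma 5.26, Lemma 5.29. [ONeill1983]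
* M. Dafermos, I. Rodnianski, arXiv:0811.0354, §5.1 (ingoing Kerr–Schild coordinates). [arXiv08110354]
* M. Dafermos, J. Luk, arXiv:1710.01722 (the Kerr interior: red-shift and no-shift regions). [DafermosLuk2017]
-/

noncomputable section

-- instance search through the nested operator types `E4 →L[ℝ] E4 →L[ℝ] E4 →L[ℝ] ℝ`
set_option maxSynthPendingDepth 3

-- D-0017: single-problem summit, `Summit.<S>.<S>.…` by design (cf. lakefile `weak.linter.dupNamespace`).
set_option linter.dupNamespace false

namespace Summit.FinalStateConjecture.FinalStateConjecture.Theorems.BartnikGapSettling.SettledCapture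

open Set Filter Function TopologicalSpace
open scoped Manifold ContDiff Topology ENNReal
open Literature.Geometry.Lorentzian Literature.Geometry.Lorentzian.MetricCoord

/-! ### Part III. The stub: transport of the certificate into `η`-good interior charts -/

section Main

/-- `Λ⁻¹((c + Λ y) − c) = y`. [folklore] -/
theorem crushTransport_poincareInv_affine (Λ : lorentzGroup) (c y : E4) :
    poincareInv Λ c (c + ((Λ : E4 ≃L[ℝ] E4) : E4 →L[ℝ] E4) y) = y := by
  simp [poincareInv]

/-- `c + Λ(Λ⁻¹(x − c)) = x`. [folklore] -/
theorem crushTransport_affine_poincareInv (Λ : lorentzGroup) (c x : E4) :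
    c + ((Λ : E4 ≃L[ℝ] E4) : E4 →L[ℝ] E4) (poincareInv Λ c x) = x := by
  simp [poincareInv]

/-- **The late shell read in rest-frame coordinates.** For the interior background with motion
`mo = (Λ, c)` and a chart map `Φ` on its domain, the parametrisation
`ψ' = Φ ∘ (chartAt E4 x₀).symm ∘ (y ↦ c + Λ y)` by the rest-frame ingoing Kerr–Schild coordinates
`y = Λ⁻¹(x − c)` satisfies `ψ'(Λ⁻¹(x − c)) = Φ x` on the domain, and the late shell
`{T < t*, r₁ < r < r₂}` corresponds to the coordinate shell `{T < y⁰, r₁ < r(a, y) < r₂}` (for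
`r₁ ≥ max r₀ 0`, so that the coordinate shell lies in the chart domain). [folklore] -/
theorem crushTransport_chart_image (mo : lorentzGroup × E4) (M a r₀ T r₁ r₂ : ℝ) (hr₀ : max r₀ 0 ≤ r₁)
    {Y : Type*} (Φ : (interiorBackground mo M a r₀).domain → Y)
    (x₀ : (interiorBackground mo M a r₀).domain) :
    (∀ x ∈ lateShell (interiorBackground mo M a r₀) T r₁ r₂,
        poincareInv mo.1 mo.2 x.1 ∈ {y : E4 | T < y 0 ∧ r₁ < Kerr.radius a y ∧ Kerr.radius a y < r₂} ∧
        ((Φ ∘ (chartAt E4 x₀).symm) ∘ fun y => mo.2 + ((mo.1 : E4 ≃L[ℝ] E4) : E4 →L[ℝ] E4) y)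
          (poincareInv mo.1 mo.2 x.1) = Φ x) ∧
    (∀ y ∈ {y : E4 | T < y 0 ∧ r₁ < Kerr.radius a y ∧ Kerr.radius a y < r₂},
        ∃ x ∈ lateShell (interiorBackground mo M a r₀) T r₁ r₂,
          (x : E4) = mo.2 + ((mo.1 : E4 ≃L[ℝ] E4) : E4 →L[ℝ] E4) y ∧ poincareInv mo.1 mo.2 x.1 = y ∧
          Φ x = ((Φ ∘ (chartAt E4 x₀).symm) ∘ fun y => mo.2 + ((mo.1 : E4 ≃L[ℝ] E4) : E4 →L[ℝ] E4) y) y) := by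
  have hψ : ∀ x : (interiorBackground mo M a r₀).domain,
      ((Φ ∘ (chartAt E4 x₀).symm) ∘ fun y => mo.2 + ((mo.1 : E4 ≃L[ℝ] E4) : E4 →L[ℝ] E4) y)
        (poincareInv mo.1 mo.2 x.1) = Φ x := by
    intro x
    simp only [comp_apply, crushTransport_affine_poincareInv]
    congr 1
    exact Subtype.ext (OpensChart.chartAt_symm_val x₀ x.2)
  refine ⟨fun x hx => ⟨hx, hψ x⟩, fun y hy => ?_⟩
  have hdom : mo.2 + ((mo.1 : E4 ≃L[ℝ] E4) : E4 →L[ℝ] E4) y ∈ (interiorBackground mo M a r₀).domain := by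
    show poincareInv mo.1 mo.2 (mo.2 + ((mo.1 : E4 ≃L[ℝ] E4) : E4 →L[ℝ] E4) y) ∈ (Kerr.region a r₀ : Set E4)
    rw [crushTransport_poincareInv_affine]
    exact Kerr.mem_region.2 (hr₀.trans_lt hy.2.1)
  refine ⟨⟨_, hdom⟩, ?_, rfl, crushTransport_poincareInv_affine mo.1 mo.2 y, ?_⟩
  · show T < poincareInv mo.1 mo.2 (mo.2 + ((mo.1 : E4 ≃L[ℝ] E4) : E4 →L[ℝ] E4) y) 0 ∧
      r₁ < Kerr.radius a (poincareInv mo.1 mo.2 (mo.2 + ((mo.1 : E4 ≃L[ℝ] E4) : E4 →L[ℝ] E4) y)) ∧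
      Kerr.radius a (poincareInv mo.1 mo.2 (mo.2 + ((mo.1 : E4 ≃L[ℝ] E4) : E4 →L[ℝ] E4) y)) < r₂
    rw [crushTransport_poincareInv_affine]
    exact hy
  · rw [← hψ ⟨_, hdom⟩]
    simp only [crushTransport_poincareInv_affine]

/-- The boosted Kerr–Schild form is `C^∞` at the points `x` with `r(Λ⁻¹(x − c)) > 0` (the Kerr–Schild
components are, `Kerr.contDiffAt_bilin`, and `x ↦ Λ⁻¹(x − c)`, `G ↦ G(Λ⁻¹·, Λ⁻¹·)` are affine resp.
continuous linear). [cite: KerrSchild1965] -/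
theorem crushTransport_contDiffAt_boostedKerrBilin (Λ : lorentzGroup) (c : E4) (M a : ℝ) {x : E4}
    (hx : 0 < Kerr.radius a (poincareInv Λ c x)) {n : ℕ∞ω} :
    ContDiffAt ℝ n (boostedKerrBilin Λ c M a) x := by
  obtain ⟨Bop, -, hBop⟩ := compAffine_exists_bilinearCompCLM ((Λ : E4 ≃L[ℝ] E4).symm : E4 →L[ℝ] E4)
  have hfun : boostedKerrBilin Λ c M a = fun x => Bop (Kerr.bilin M a (poincareInv Λ c x)) := by
    funext x
    ext v w
    rw [hBop, ContinuousLinearMap.bilinearComp_apply, boostedKerrBilin_apply]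
    rfl
  rw [hfun]
  have hP : ContDiff ℝ n (poincareInv Λ c) :=
    ((Λ : E4 ≃L[ℝ] E4).symm : E4 →L[ℝ] E4).contDiff.comp (contDiff_id.sub contDiff_const)
  exact Bop.contDiff.contDiffAt.comp x ((Kerr.contDiffAt_bilin M a hx).comp x hP.contDiffAt)

set_option maxHeartbeats 1600000 in
/-- **The `η`-good interior chart read in rest-frame ingoing Kerr–Schild coordinates.** For an
`η`-good interior chart `Φ` on the late shell `{T < t*, r₁ < r < r₂}` (`η = ENNReal.ofReal η₀`,
`r₁ ≥ max r₋ 0`), the parametrisation `ψ' = Φ ∘ (chartAt E4 x₀).symm ∘ (y ↦ c + Λ y)` is, on the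
coordinate shell `A = {T < y⁰, r₁ < r(a,y) < r₂}`: `C^∞`; injective; `C¹`-close to the Kerr–Schild
components, `‖ψ'^* g(y) − g_{M,a}(y)‖ ≤ ‖Λ‖² η₀` and `‖D(ψ'^* g)(y) − Dg_{M,a}(y)‖ ≤ ‖Λ‖³ η₀`
(transformation law of the components under the affine change of chart, O'Neill 1983, Ch. 3, p. 58,
and the chain rule); and it pushes the Kerr field `V_{M,a}` forward to a future-directed vector.
[cite: ONeill1983, Ch. 3, p. 58] -/
theorem crushTransport_chart_package {X : Type} [TopologicalSpace X] [ChartedSpace E3 X]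
    [IsManifold (𝓡 3) ((⊤ : ℕ∞) : WithTop ℕ∞) X] [ConnectedSpace X] {D : InitialDataSet (𝓡 3) X}
    (𝒟 : VacuumCauchyDevelopment D) (mo : lorentzGroup × E4) {M a T r₁ r₂ η₀ : ℝ} (hη₀ : 0 ≤ η₀)
    (hr₀ : max (Kerr.rMinus M a) 0 ≤ r₁)
    {Φ : (interiorBackground mo M a (Kerr.rMinus M a)).domain → 𝒟.carrier}
    (hgood : IsGoodInteriorChart 𝒟 mo M a Φ T r₁ r₂ (ENNReal.ofReal η₀))
    (x₀ : (interiorBackground mo M a (Kerr.rMinus M a)).domain) {L : E4 →L[ℝ] E4}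
    (hL : L = ((mo.1 : E4 ≃L[ℝ] E4) : E4 →L[ℝ] E4)) {ψ' : E4 → 𝒟.carrier}
    (hψ' : ψ' = (Φ ∘ (chartAt E4 x₀).symm) ∘ fun y => mo.2 + L y) {A : Set E4}
    (hA : A = {y : E4 | T < y 0 ∧ r₁ < Kerr.radius a y ∧ Kerr.radius a y < r₂}) :
    ContMDiffOn 𝓘(ℝ, E4) (𝓡 4) ((⊤ : ℕ∞) : WithTop ℕ∞) ψ' A ∧ InjOn ψ' A ∧
      (∀ y ∈ A, ‖𝒟.toSpacetime.metricInCoords ψ' y - Kerr.bilin M a y‖ ≤ ‖L‖ ^ 2 * η₀ ∧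
        ‖fderiv ℝ (𝒟.toSpacetime.metricInCoords ψ') y - fderiv ℝ (Kerr.bilin M a) y‖ ≤ ‖L‖ ^ 3 * η₀) ∧
      (∀ y ∈ A, 𝒟.timeOrientation.IsFutureDirected
        (mfderiv 𝓘(ℝ, E4) (𝓡 4) ψ' y (Kerr.timeVector M a y))) := by
  subst hψ'
  obtain ⟨hΦ, hemb, -, hfut, hsup⟩ := hgood
  set S : Set (interiorBackground mo M a (Kerr.rMinus M a)).domain :=
    lateShell (interiorBackground mo M a (Kerr.rMinus M a)) T r₁ r₂ with hS
  set ψ : E4 → 𝒟.carrier := Φ ∘ (chartAt E4 x₀).symm with hψdef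
  set τ : E4 → E4 := fun y => mo.2 + L y with hτdef
  set O : Set E4 := {x | poincareInv mo.1 mo.2 x ∈ A} with hOdef
  have hSo : IsOpen S := stub_isOpen_lateShell_interiorBackground mo M a _ T r₁ r₂
  have hAo : IsOpen A := by
    rw [hA]
    exact (isOpen_lt continuous_const (E4.dx 0).continuous).inter
      ((isOpen_lt continuous_const (Kerr.continuous_radius a)).inter
        (isOpen_lt (Kerr.continuous_radius a) continuous_const))
  have hOo : IsOpen O := hAo.preimage (continuous_poincareInv _ _)
  have hApos : ∀ y ∈ A, 0 < Kerr.radius a y := fun y hy => by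
    rw [hA] at hy
    exact ((le_max_right _ _).trans hr₀).trans_lt hy.2.1
  have hOdom : O ⊆ ((interiorBackground mo M a (Kerr.rMinus M a)).domain : Set E4) := fun x hx => by
    have hx' : poincareInv mo.1 mo.2 x ∈ A := hx
    rw [hA] at hx'
    exact Kerr.mem_region.2 (hr₀.trans_lt hx'.2.1)
  -- membership dictionary between `O`, `S` and `A`
  have hOS : ∀ x (hx : x ∈ O), (⟨x, hOdom hx⟩ : (interiorBackground mo M a (Kerr.rMinus M a)).domain) ∈ S := fun x hx => by
    have hx' : poincareInv mo.1 mo.2 x ∈ A := hx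
    rw [hA] at hx'
    exact hx'
  have hOval : O ⊆ Subtype.val '' S := fun x hx => ⟨⟨x, hOdom hx⟩, hOS x hx, rfl⟩
  have hτP : ∀ y : E4, poincareInv mo.1 mo.2 (τ y) = y := fun y => by
    rw [hτdef, hL]
    exact crushTransport_poincareInv_affine mo.1 mo.2 y
  have hτO : ∀ y ∈ A, τ y ∈ O := fun y hy => by
    show poincareInv mo.1 mo.2 (τ y) ∈ A
    rw [hτP]
    exact hy
  have hpre : τ ⁻¹' O = A := by
    ext y
    show poincareInv mo.1 mo.2 (τ y) ∈ A ↔ y ∈ A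
    rw [hτP]
  have hsymm : ∀ x (hx : x ∈ ((interiorBackground mo M a (Kerr.rMinus M a)).domain : Set E4)), (chartAt E4 x₀).symm x = ⟨x, hx⟩ := fun x hx =>
    Subtype.ext (OpensChart.chartAt_symm_val x₀ hx)
  -- (1) smoothness of `ψ` on `O` and of `ψ ∘ τ` on `A`
  have hψO : ContMDiffOn 𝓘(ℝ, E4) (𝓡 4) ((⊤ : ℕ∞) : WithTop ℕ∞) ψ O := by
    refine hΦ.comp ((contMDiffOn_chart_symm (x := x₀)).mono ?_) fun x hx => ?_
    · rw [OpensChart.chartAt_target]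
      exact hOdom
    · show (chartAt E4 x₀).symm x ∈ S
      rw [hsymm x (hOdom hx)]
      exact hOS x hx
  obtain ⟨hψ'A, hcomp, -⟩ := stub_metricInCoords_comp_affine 𝒟.toSpacetime ψ L mo.2 O hOo hψO
  rw [hpre] at hψ'A
  -- (2) the deviation and its `C¹` bounds on `O`
  set dev := 𝒟.toSpacetime.deviationExtend (interiorBackground mo M a (Kerr.rMinus M a)) Φ with hdev
  have hdev0 : ∀ x ∈ O, ‖dev x‖ ≤ η₀ := fun x hx => by
    have h := (enorm_iteratedFDeriv_le_supCkENorm (k := 1) (m := 0) zero_le_one (hOval hx) dev).trans hsup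
    rwa [← ofReal_norm, ENNReal.ofReal_le_ofReal_iff hη₀, norm_iteratedFDeriv_zero] at h
  have hdev1 : ∀ x ∈ O, ‖fderiv ℝ dev x‖ ≤ η₀ := fun x hx => by
    have h := (enorm_iteratedFDeriv_le_supCkENorm (k := 1) (m := 1) le_rfl (hOval hx) dev).trans hsup
    rwa [← ofReal_norm, ENNReal.ofReal_le_ofReal_iff hη₀, norm_iteratedFDeriv_one] at h
  have hΦd : ∀ x (hx : x ∈ O), MDifferentiableAt 𝓘(ℝ, E4) (𝓡 4) Φ ⟨x, hOdom hx⟩ := fun x hx =>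
    ((hΦ _ (hOS x hx)).contMDiffAt (hSo.mem_nhds (hOS x hx))).mdifferentiableAt (by simp)
  have hdevO : ∀ x ∈ O,
      𝒟.toSpacetime.metricInCoords ψ x - boostedKerrBilin mo.1 mo.2 M a x = dev x := fun x hx => by
    have h := 𝒟.toSpacetime.metricInCoords_comp_chartAt_symm_sub_eq_deviation
      (interiorBackground mo M a (Kerr.rMinus M a)) Φ x₀ (hOdom hx) (hΦd x hx)
    have h' := Spacetime.deviationExtend_coe 𝒟.toSpacetime (interiorBackground mo M a (Kerr.rMinus M a)) Φ
      ⟨x, hOdom hx⟩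
    exact h.trans h'.symm
  have hmψ : ContDiffOn ℝ ((⊤ : ℕ∞) : WithTop ℕ∞) (𝒟.toSpacetime.metricInCoords ψ) O :=
    𝒟.toSpacetime.contDiffOn_metricInCoords hOo hψO
  have hbK : ∀ x ∈ O, ContDiffAt ℝ ((⊤ : ℕ∞) : WithTop ℕ∞) (boostedKerrBilin mo.1 mo.2 M a) x :=
    fun x hx => crushTransport_contDiffAt_boostedKerrBilin mo.1 mo.2 M a (hApos _ hx)
  have hdevd : ∀ x ∈ O, DifferentiableAt ℝ dev x := by
    intro x hx
    have hev : dev =ᶠ[𝓝 x] fun x => 𝒟.toSpacetime.metricInCoords ψ x - boostedKerrBilin mo.1 mo.2 M a x :=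
      Filter.eventuallyEq_of_mem (hOo.mem_nhds hx) fun x' hx' => (hdevO x' hx').symm
    have hd1 : DifferentiableAt ℝ (𝒟.toSpacetime.metricInCoords ψ) x :=
      (hmψ.contDiffAt (hOo.mem_nhds hx)).differentiableAt (by simp)
    have hd2 : DifferentiableAt ℝ (boostedKerrBilin mo.1 mo.2 M a) x :=
      (hbK x hx).differentiableAt (by simp)
    exact (hd1.sub hd2).congr_of_eventuallyEq hev
  -- (3) the components of `ψ ∘ τ` minus Kerr are the boosted deviation
  obtain ⟨Bop, hBopn, hBop⟩ := compAffine_exists_bilinearCompCLM L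
  have hKL : ∀ y : E4, Bop (boostedKerrBilin mo.1 mo.2 M a (τ y)) = Kerr.bilin M a y := fun y => by
    rw [hBop]
    ext v w
    rw [ContinuousLinearMap.bilinearComp_apply, boostedKerrBilin_apply, hτP, hL]
    simp
  have hDev' : ∀ y ∈ A, 𝒟.toSpacetime.metricInCoords (ψ ∘ τ) y - Kerr.bilin M a y = Bop (dev (τ y)) :=
    fun y hy => by
    rw [hcomp y (hτO y hy), ← hBop, ← hKL y, ← map_sub, hdevO _ (hτO y hy)]
  have hC0 : ∀ y ∈ A, ‖𝒟.toSpacetime.metricInCoords (ψ ∘ τ) y - Kerr.bilin M a y‖ ≤ ‖L‖ ^ 2 * η₀ :=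
    fun y hy => by
    rw [hDev' y hy]
    calc ‖Bop (dev (τ y))‖ ≤ ‖Bop‖ * ‖dev (τ y)‖ := Bop.le_opNorm _
      _ ≤ (‖L‖ * ‖L‖) * η₀ :=
          mul_le_mul hBopn (hdev0 _ (hτO y hy)) (norm_nonneg _) (by positivity)
      _ = ‖L‖ ^ 2 * η₀ := by ring
  have hτd : ∀ y : E4, HasFDerivAt τ L y := fun y => by
    have h : HasFDerivAt (fun y : E4 => mo.2 + L y) L y := (L.hasFDerivAt).const_add mo.2
    exact h
  have hC1 : ∀ y ∈ A, ‖fderiv ℝ (𝒟.toSpacetime.metricInCoords (ψ ∘ τ)) y - fderiv ℝ (Kerr.bilin M a) y‖ ≤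
      ‖L‖ ^ 3 * η₀ := fun y hy => by
    have hin : HasFDerivAt (dev ∘ τ) ((fderiv ℝ dev (τ y)).comp L) y :=
      HasFDerivAt.comp y (hg := (hdevd _ (hτO y hy)).hasFDerivAt) (hf := hτd y)
    have hchain : HasFDerivAt ((Bop : (E4 →L[ℝ] E4 →L[ℝ] ℝ) → (E4 →L[ℝ] E4 →L[ℝ] ℝ)) ∘ (dev ∘ τ))
        ((Bop : _ →L[ℝ] _).comp ((fderiv ℝ dev (τ y)).comp L)) y :=
      HasFDerivAt.comp y (hg := Bop.hasFDerivAt) (hf := hin)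
    have hev : (fun y => 𝒟.toSpacetime.metricInCoords (ψ ∘ τ) y - Kerr.bilin M a y) =ᶠ[𝓝 y]
        ((Bop : (E4 →L[ℝ] E4 →L[ℝ] ℝ) → (E4 →L[ℝ] E4 →L[ℝ] ℝ)) ∘ (dev ∘ τ)) :=
      Filter.eventuallyEq_of_mem (hAo.mem_nhds hy) fun y' hy' => hDev' y' hy'
    have hd1 : DifferentiableAt ℝ (𝒟.toSpacetime.metricInCoords (ψ ∘ τ)) y :=
      ((𝒟.toSpacetime.contDiffOn_metricInCoords hAo hψ'A).contDiffAt (hAo.mem_nhds hy)).differentiableAt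
        (by simp)
    have hd2 : DifferentiableAt ℝ (Kerr.bilin M a) y :=
      (Kerr.contDiffAt_bilin M a (hApos y hy) (n := 1)).differentiableAt one_ne_zero
    have e : fderiv ℝ (𝒟.toSpacetime.metricInCoords (ψ ∘ τ)) y - fderiv ℝ (Kerr.bilin M a) y =
        (Bop : _ →L[ℝ] _).comp ((fderiv ℝ dev (τ y)).comp L) := by
      rw [← fderiv_fun_sub hd1 hd2, hev.fderiv_eq, hchain.fderiv]
    rw [e]
    calc ‖(Bop : _ →L[ℝ] _).comp ((fderiv ℝ dev (τ y)).comp L)‖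
        ≤ ‖Bop‖ * ‖(fderiv ℝ dev (τ y)).comp L‖ := ContinuousLinearMap.opNorm_comp_le _ _
      _ ≤ ‖Bop‖ * (‖fderiv ℝ dev (τ y)‖ * ‖L‖) := by
          gcongr
          exact ContinuousLinearMap.opNorm_comp_le _ _
      _ ≤ (‖L‖ * ‖L‖) * (η₀ * ‖L‖) :=
          mul_le_mul hBopn (mul_le_mul_of_nonneg_right (hdev1 _ (hτO y hy)) (norm_nonneg _))
            (by positivity) (by positivity)
      _ = ‖L‖ ^ 3 * η₀ := by ring
  -- (4) orientation
  have hψτ : ∀ y (hy : y ∈ A), (ψ ∘ τ) y = Φ ⟨τ y, hOdom (hτO y hy)⟩ := fun y hy => by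
    show Φ ((chartAt E4 x₀).symm (τ y)) = _
    rw [hsymm]
  have hF : ∀ y ∈ A, 𝒟.timeOrientation.IsFutureDirected
      (mfderiv 𝓘(ℝ, E4) (𝓡 4) (ψ ∘ τ) y (Kerr.timeVector M a y)) := fun y hy => by
    have hx := hτO y hy
    have hψd : MDifferentiableAt 𝓘(ℝ, E4) (𝓡 4) ψ (τ y) :=
      ((hψO _ hx).contMDiffAt (hOo.mem_nhds hx)).mdifferentiableAt (by simp)
    have hτd' : MDifferentiableAt 𝓘(ℝ, E4) 𝓘(ℝ, E4) τ y :=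
      mdifferentiableAt_iff_differentiableAt.mpr (hτd y).differentiableAt
    have h1 : mfderiv 𝓘(ℝ, E4) (𝓡 4) (ψ ∘ τ) y (Kerr.timeVector M a y) =
        mfderiv 𝓘(ℝ, E4) (𝓡 4) ψ (τ y) (L (Kerr.timeVector M a y)) := by
      rw [mfderiv_comp y hψd hτd', mfderiv_eq_fderiv, (hτd y).fderiv]
      rfl
    have h2 : mfderiv 𝓘(ℝ, E4) (𝓡 4) ψ (τ y) (L (Kerr.timeVector M a y)) =
        mfderiv 𝓘(ℝ, E4) (𝓡 4) Φ ⟨τ y, hOdom hx⟩ (L (Kerr.timeVector M a y)) :=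
      𝒟.toSpacetime.mfderiv_comp_chartAt_symm_apply (interiorBackground mo M a (Kerr.rMinus M a)) Φ x₀ (hOdom hx) (hΦd _ hx) _
    have h3 := hfut ⟨τ y, hOdom hx⟩ (hOS _ hx)
    have h4 : (mo.1 : E4 ≃L[ℝ] E4) (Kerr.timeVector M a (poincareInv mo.1 mo.2 (τ y))) =
        L (Kerr.timeVector M a y) := by
      rw [hτP, hL]
      rfl
    rw [h1, h2, ← h4, hψτ y hy]
    exact h3
  -- (5) injectivity
  have hinj : InjOn (ψ ∘ τ) A := by
    intro y₁ h₁ y₂ h₂ heq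
    rw [hψτ y₁ h₁, hψτ y₂ h₂] at heq
    have h := hemb.injective (a₁ := ⟨⟨τ y₁, hOdom (hτO y₁ h₁)⟩, hOS _ (hτO y₁ h₁)⟩)
      (a₂ := ⟨⟨τ y₂, hOdom (hτO y₂ h₂)⟩, hOS _ (hτO y₂ h₂)⟩) heq
    have hτ12 : τ y₁ = τ y₂ := congrArg (fun z : S => ((z : (interiorBackground mo M a (Kerr.rMinus M a)).domain) : E4)) h
    have h' := congrArg (poincareInv mo.1 mo.2) hτ12
    rwa [hτP, hτP] at h'
  exact ⟨hψ'A, hinj, fun y hy => ⟨hC0 y hy, hC1 y hy⟩, hF⟩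

/-- **Registered sub-goal `stub_crushTransportChart`** (helper of stub `stub_crushTransport`, line
`null-concave-crush`): the `η`-good interior chart read in rest-frame ingoing Kerr–Schild coordinates, i.e.
`crushTransport_chart_package` in registered one-line form. [cite: ONeill1983, Ch. 3, p. 58] -/
theorem stub_crushTransportChart : ∀ (X : Type) [TopologicalSpace X] [ChartedSpace E3 X] [IsManifold (𝓡 3) ((⊤ : ℕ∞) : WithTop ℕ∞) X] [ConnectedSpace X] (D : InitialDataSet (𝓡 3) X) (𝒟 : VacuumCauchyDevelopment D) (mo : lorentzGroup × E4) (M a T r₁ r₂ η₀ : ℝ), 0 ≤ η₀ → max (Kerr.rMinus M a) 0 ≤ r₁ → ∀ (Φ : (interiorBackground mo M a (Kerr.rMinus M a)).domain → 𝒟.carrier), IsGoodInteriorChart 𝒟 mo M a Φ T r₁ r₂ (ENNReal.ofReal η₀) → ∀ (x₀ : (interiorBackground mo M a (Kerr.rMinus M a)).domain), ContMDiffOn 𝓘(ℝ, E4) (𝓡 4) ((⊤ : ℕ∞) : WithTop ℕ∞) ((Φ ∘ (chartAt E4 x₀).symm) ∘ fun y => mo.2 + ((mo.1 : E4 ≃L[ℝ]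 E4) : E4 →L[ℝ] E4) y) {y : E4 | T < y 0 ∧ r₁ < Kerr.radius a y ∧ Kerr.radius a y < r₂} ∧ Set.InjOn ((Φ ∘ (chartAt E4 x₀).symm) ∘ fun y => mo.2 + ((mo.1 : E4 ≃L[ℝ] E4) : E4 →L[ℝ] E4) y) {y : E4 | T < y 0 ∧ r₁ < Kerr.radius a y ∧ Kerr.radius a y < r₂} ∧ (∀ y ∈ {y : E4 | T < y 0 ∧ r₁ < Kerr.radius a y ∧ Kerr.radius a y < r₂}, ‖𝒟.toSpacetime.metricInCoords ((Φ ∘ (chartAt E4 x₀).symm) ∘ fun y => mo.2 + ((mo.1 : E4 ≃L[ℝ] E4) : E4 →L[ℝ] E4) y) y - Kerr.bilin M a y‖ ≤ ‖((mo.1 : E4 ≃L[ℝ] E4) : E4 →L[ℝ] E4)‖ ^ 2 * η₀ ∧ ‖fderiv ℝ (𝒟.toSpacetime.metricInCoords ((Φ ∘ (chartAt E4 x₀).symm) ∘ fun y => mo.2 + ((mo.1 : E4 ≃L[ℝ] E4) : E4 →L[ℝ] E4) y)) y - fderiv ℝ (Kerr.bilin M a) y‖ ≤ ‖((mo.1 :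 E4 ≃L[ℝ] E4) : E4 →L[ℝ] E4)‖ ^ 3 * η₀) ∧ ∀ y ∈ {y : E4 | T < y 0 ∧ r₁ < Kerr.radius a y ∧ Kerr.radius a y < r₂}, 𝒟.timeOrientation.IsFutureDirected (mfderiv 𝓘(ℝ, E4) (𝓡 4) ((Φ ∘ (chartAt E4 x₀).symm) ∘ fun y => mo.2 + ((mo.1 : E4 ≃L[ℝ] E4) : E4 →L[ℝ] E4) y) y (Kerr.timeVector M a y)) := by
  intro X _ _ _ _ D 𝒟 mo M a T r₁ r₂ η₀ hη₀ hr₁ Φ hgood x₀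
  exact crushTransport_chart_package 𝒟 mo hη₀ hr₁ hgood x₀ rfl rfl rfl

end Main

end Summit.FinalStateConjecture.FinalStateConjecture.Theorems.BartnikGapSettling.SettledCapture

end
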